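import Mathlib
import HarnessLib
import Summits.HubbardSuperconductivity.HubbardSuperconductivity.Theorems.ComplexGFFStiffnessHypALocalTwoPointFreeEnergyClause3
import Summits.HubbardSuperconductivity.HubbardSuperconductivity.Theorems.ComplexGFFStiffnessHypALocalTwoPointFreeEnergyClause2
import Summits.HubbardSuperconductivity.HubbardSuperconductivity.Theorems.ComplexGFFStiffnessHypACumulantIotaTuning

/-!
# Crux `HypALocalTwoPoint`, line `gnv` — the free energy at fixed `(L, N)`: CHOICE of the tuned seeds and
# the three clauses of `FreeEnergyBounds` with `N`-free constants (census F1 (iv), choice-function step)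

Route `route-HubbardSuperconductivity-ComplexGFFStiffness`, crux item stmt-HubbardSuperconductivity-19155,
registered stub `stub_twoPointGivenZ` (⇐ `FreeEnergyBounds`, p817758).  Under the [ABKM19] package at
fixed `(L, N)` and given the `q`-regularity hypotheses (census F4/F5, abstract interface), the tuned
`ι`-seed `x₀(K)` of every `ι`-admissible perturbation `K` is CHOSEN
(`exists_tuned_initial_iota_of_torusFRD`) and `fE K := log κ + |Λ|λ(x₀(K)) + Log I(K, x₀(K))` satisfies
both difference clauses of `FreeEnergyBounds` at this `(L, N)` (constants of `…FreeEnergyClause2/3`):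
**`exists_freeEnergy_of_package`**.  With `pertZ_eq_Z0_mul_exp_freeEnergyPiece` (d = 4) conjunct (0)
gives `pertZ = Z₀·exp(fE K)`; what remains of census F1 is the per-`L` parameter choice
(`gnv_of_torusFRD`).  Conditional on F4/F5 (hypotheses); no `sorry`, no new named fact.

Reference: S. Adams, S. Buchholz, R. Kotecký, S. Müller, arXiv:1910.13564, Thm 2.2 [AdamsBuchholzKoteckyMuller2019]. -/






noncomputable section

-- `Summit.<Summit>.<Problem>`: single-conjunct summit, the duplicate component is mandated (D-0017).
set_option linter.dupNamespace false

namespace Summit.HubbardSuperconductivity.HubbardSuperconductivity.Theorems.ComplexGFF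

open scoped BigOperators ComplexConjugate
open Real Set Finset MeasureTheory
open Literature.MathematicalPhysics.StatisticalMechanics.GradientRG
open Literature.MathematicalPhysics.StatisticalMechanics.GradientFRD
  (fourierCoeff cExt cExt_of_mem IsElliptic IsUnitSymm InShell iterDiff supNorm conv ellOp isElliptic_one)
open Literature.MathematicalPhysics.StatisticalMechanics.TorusPolymer
  (IsPolymer numBlocks blockOf boxCorner isPolymer_blockOf isConn_blockOf pcirc)
open Literature.Barriers.CriticalPhenomena.LongRangePhi4.Polymer (IsConn components)
open Literature.MathematicalPhysics.QuantumFieldTheory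
open Literature.Dynamics.Hyperbolic

variable {d M : ℕ} [NeZero M]

section Package

variable {L N Mord R n ñ : ℕ} {θbar lam μ δ₁ δ₀ A𝒫 : ℝ}
    {𝒞 : Matrix (Fin d) (Fin d) ℝ → ℕ → (Fin d → ZMod M) → ℝ} {Mc : ℕ → ℝ}
    {Cα : (Fin d → ℕ) → ℕ → ℝ} {c C : ℝ} {Cℓ : ℕ → ℝ}

set_option maxHeartbeats 6400000 in
/-- **The free energy at fixed `(L, N)` with a CHOICE of the tuned seeds** ([ABKM19] Theorem 2.2,
difference form, `ι`-symmetric complex class; census F1 (iv), choice-function step): under the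
[ABKM19] package at fixed `(L, N)` and GIVEN the `q`-regularity hypotheses (census F4/F5, abstract
interface) with the smallness (12.54)–(12.56), there is a function `fE` on perturbations such that
(0) for every `ι`-admissible `K` of size `ρ𝒦`, `fE K = log κ + |Λ|λ(x₀) + Log I(K, x₀)` for a tuned `ι`-seed
`x₀` of `K` with `‖I − 1‖ ≤ εη^N A⁻¹A_𝒫` (so `pertZ = Z₀·exp(fE K)` in `d = 4`, `…FreeEnergyRepresentation`);
(2) first differences `‖fE(K+U) − fE K‖ ≤ C₂·|Λ|·u`; (3) mixed second differences `≤ C₃·|Λ|·u₁u₂`, with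
the `N`-free constants of `…FreeEnergyClause2/3`. -/
theorem exists_freeEnergy_of_package {h : ℝ} [Fact (0 < h)] [Fact (0 < L)]
    (hd : 3 ≤ d) (hMord : 1 ≤ Mord) (hMR : Mord ≤ R) (hLodd : Odd L) (hL : 2 ^ (d + 3) + 16 * R ≤ L)
    (hR2 : 2 ≤ R) (hM : M = L ^ N)
    (hθbar : 0 < θbar) (hlam : 0 < lam) (hn : 2 * Mord ≤ n) (hn2 : 2 ≤ n) (hnñ : n ≤ ñ)
    (hc : 0 < c) (hC1 : 0 ≤ Cℓ 1)
    (hallA : ∀ A : Matrix (Fin d) (Fin d) ℝ, IsElliptic (1 / 2 : ℝ) 2 A →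
        (∀ k, 1 ≤ k → k ≤ N + 1 →
          ∑ x : Fin d → ZMod M, 𝒞 A k x = 0 ∧ ∀ x, 𝒞 A k (-x) = 𝒞 A k x) ∧
        (∀ k, 1 ≤ k → k ≤ N + 1 → ∀ φ : (Fin d → ZMod M) → ℝ, ∑ x, φ x = 0 →
          0 ≤ ∑ x, ∑ y, φ x * 𝒞 A k (x - y) * φ y) ∧
        (∀ φ : (Fin d → ZMod M) → ℝ, ∑ x, φ x = 0 →
          ellOp A (conv (fun x => ∑ k ∈ Finset.Icc 1 (N + 1), 𝒞 A k x) φ) = φ) ∧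
        (∀ k, 1 ≤ k → k ≤ N → Mc k ≤ 0 ∧
          ∀ x : Fin d → ZMod M, ((L : ℝ) ^ k) / 2 ≤ (supNorm x : ℝ) →
            𝒞 A k x = Mc k) ∧
        (∀ k, 1 ≤ k → k ≤ N + 1 → ∀ B : Matrix (Fin d) (Fin d) ℝ, IsUnitSymm B →
          (∃ ε : ℝ, 0 < ε ∧ ∀ x : Fin d → ZMod M,
            ContDiffOn ℝ ⊤ (fun s : ℝ => 𝒞 (A + s • B) k x) (Set.Ioo (-ε) ε)) ∧
          ∀ α : Fin d → ℕ, ∑ i, α i ≤ n → ∀ ℓ : ℕ, ∀ x : Fin d → ZMod M,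
            abs (iteratedDeriv ℓ (fun s : ℝ => iterDiff α (𝒞 (A + s • B) k) x) 0)
              ≤ Cα α ℓ / (L : ℝ) ^ ((k - 1) * (d - 2 + ∑ i, α i))) ∧
        (∀ k, 1 ≤ k → k ≤ N + 1 → ∀ j : ℕ, ∀ κ : Fin d → ZMod M, κ ≠ 0 → InShell L j κ →
          (j < k →
            c / (L : ℝ) ^ (2 * (d + ñ) + 1) * (L : ℝ) ^ (2 * j)
                / (L : ℝ) ^ ((k - j) * (d - 1 + n)) ≤ (fourierCoeff (𝒞 A k) κ).re ∧
            ‖fourierCoeff (𝒞 A k) κ‖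
              ≤ C * (L : ℝ) ^ (2 * (d + ñ) + 1) * (L : ℝ) ^ (2 * j)
                  / (L : ℝ) ^ ((k - j) * (d - 1 + n))) ∧
          (k ≤ j →
            c / (L : ℝ) ^ (2 * (d + ñ) + 1) * (L : ℝ) ^ (2 * k)
                ≤ (fourierCoeff (𝒞 A k) κ).re ∧
            ‖fourierCoeff (𝒞 A k) κ‖ ≤ C * (L : ℝ) ^ (2 * k)) ∧
          ∀ B : Matrix (Fin d) (Fin d) ℝ, IsUnitSymm B → ∀ ℓ : ℕ, 1 ≤ ℓ →
            (j < k →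
              ‖iteratedDeriv ℓ (fun s : ℝ => fourierCoeff (𝒞 (A + s • B) k) κ) 0‖
                ≤ Cℓ ℓ * (L : ℝ) ^ (2 * (d + ñ) + 1) * (L : ℝ) ^ (2 * j)
                    / (L : ℝ) ^ ((k - j) * (d - 1 + ñ))) ∧
            (k ≤ j →
              ‖iteratedDeriv ℓ (fun s : ℝ => fourierCoeff (𝒞 (A + s • B) k) κ) 0‖
                ≤ Cℓ ℓ * (L : ℝ) ^ (2 * k))))
    (hB : AbkmWeightBounds L N Mord R n θbar lam μ δ₁ δ₀ A𝒫 (fun j => 𝒞 1 j)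
      (abkmWeightData L N Mord R θbar (schedDelta δ₀ δ₁ N) fun j => 𝒞 1 j))
    {pT r₀ : ℕ} (hp : d / 2 + 2 ≤ pT) (hpM : pT + d ≤ Mord) (hr₀ : 3 ≤ r₀)
    (hδ₀ : 0 < δ₀) (hδ₁ : 0 < δ₁) (hh0 : hZeroSq d R δ₀ δ₁ ≤ h ^ 2)
    (hh2 : secondDiffConst (fun θ' => Cα θ' 0) ≤ h ^ 2)
    -- the tuning ball
    {θ : ℝ} (hθ0 : 0 ≤ θ) (hθ : θ < θbar)
    {T₀ : ℝ} (hT₀ : T₀ ≤ 1 / 2) (hKT₀ : shellRatioConst c (Cℓ 1) (L : ℝ) d ñ * T₀ ≤ Real.log (1 + θ))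
    {A𝒫' : ℝ} (hA𝒫' : weightIntConstRho θbar θ (traceConst d Mord R lam (derivSum d n fun θ' _ => Cα θ' 0)) = A𝒫')
    -- the side conditions of Theorem 6.8 (`RGStepABKMQ`), at `A_𝒫' = A_𝒫(θ)`
    {A : ℝ} (hA1 : 1 ≤ A) (hA𝒫A : A𝒫' ≤ A)
    (hsmall : (2 : ℝ) ^ (L ^ d) * (A𝒫' * A ^ (-(1 - (1 + 1 / ((2 * (2 ^ d + 1) + 6 : ℝ) ^ d))⁻¹) : ℝ)) ≤ 1)
    {r : ℝ} (hr0 : 0 ≤ r) (hr : r ≤ 1 / 64)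
    (hv : vABKM d R A A𝒫' r ≤ 1 / 64) (hωA : omegaABKM d R A A𝒫' r * A ^ 2 ≤ 1)
    (hc3A : (kappaABKM d R A A𝒫' r) ^ (L ^ d) * ((2 * (2 * (kappaABKM d R A A𝒫' r) * max 1 A𝒫')) ^ ((2 ^ (d + 1) + 2) ^ d * L ^ d) * (4 : ℝ) ^ ((2 ^ (d + 1) + 2) ^ d * L ^ d)) ≤ A ^ ((1 + 1 / ((2 * (2 ^ d + 1) + 6 : ℝ) ^ d)) - 1 : ℝ))
    (hc2A : (kappaABKM d R A A𝒫' r) ^ (L ^ d) * ((2 * (kappaABKM d R A A𝒫' r) * max 1 A𝒫') ^ ((2 ^ (d + 1) + 2) ^ d * L ^ d) * (2 : ℝ) ^ ((2 ^ (d + 1) + 2) ^ d * L ^ d)) ≤ A ^ ((1 + 1 / ((2 * (2 ^ d + 1) + 6 : ℝ) ^ d)) - 1 : ℝ))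
    -- the contraction regime of Ch. 12
    {η κ ε ρ : ℝ} (hη : 0 < η) (hη1 : η ≤ 1)
    (hκ₁ : (3 / 4 : ℝ) * (η + (L : ℝ) ^ d * (pi2BoundConst d (((2 * R + 2 : ℕ) : ℝ) + ((d / 2 + 1 : ℕ) : ℝ)) * (A𝒫' * A⁻¹))) ≤ κ)
    (hκ₂ : sigmaABKM d L R A A𝒫' r ≤ κ * η) (hκ : κ < 1)
    (hε : 0 ≤ ε) (hεr : 3 * ε ≤ r) (hερ : 3 * ε ≤ ρ) (hρ64 : ρ ≤ 1 / 64)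

    (hp4 : 4 * pT ≤ 2 ^ (d + 2))
    (hqT₀ : 2 * (d : ℝ) ^ 2 / (((L ^ (d * 0) : ℕ) : ℝ) * (fieldWt h (L : ℝ) d 0 / (L : ℝ) ^ 0) ^ 2) * ρ ≤ T₀)
    (hqε : 2 * (d : ℝ) ^ 2 / (((L ^ (d * 0) : ℕ) : ℝ) * (fieldWt h (L : ℝ) d 0 / (L : ℝ) ^ 0) ^ 2) * ε ≤ 1 / 6)
    -- the radius of the perturbations
    {ρ𝒦 : ℝ}
    (h𝒦small : (Real.exp (1 / 4) + 2 * Real.exp (3 / 8)) * (ρ𝒦 * Real.exp (fieldWt h (L : ℝ) d 0 / (L : ℝ) ^ 0)) * A ≤ 1 / 2)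
    (h𝒦ε : Real.exp (1 / 4) * (ρ𝒦 * Real.exp (fieldWt h (L : ℝ) d 0 / (L : ℝ) ^ 0)) * A ≤ ε)
    -- the `h`-indexed system (abbreviations fixed by their defining equations)
    (Asys : (fun k => HamSpace ℂ d (fieldWt h (L : ℝ) d k) ((L : ℝ) ^ k) (L ^ (d * k))) 0 → (k : ℕ) → ((fun k => HamSpace ℂ d (fieldWt h (L : ℝ) d k) ((L : ℝ) ^ k) (L ^ (d * k))) k ≃L[ℝ] (fun k => HamSpace ℂ d (fieldWt h (L : ℝ) d k) ((L : ℝ) ^ k) (L ^ (d * k))) (k + 1)))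
    (hAsys : Asys = fun h₀ => rgA L h (fun j => 𝒞 ((1 : Matrix (Fin d) (Fin d) ℝ) + hamTuningMap ρ h₀) j))
    (Bsys : (fun k => HamSpace ℂ d (fieldWt h (L : ℝ) d k) ((L : ℝ) ^ k) (L ^ (d * k))) 0 → (k : ℕ) → ((fun k => activitySpace (abkmNormParams L N Mord R pT r₀ h θbar A (schedDelta δ₀ δ₁ N) fun j => 𝒞 1 j) k) k →+ (fun k => HamSpace ℂ d (fieldWt h (L : ℝ) d k) ((L : ℝ) ^ k) (L ^ (d * k))) (k + 1)))
    (hBsys : Eq Bsys fun h₀ =>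
      rgBT hd hMord hMR hLodd hL hM hθbar hlam hn hn2 hnñ hc hC1 hallA hB pT r₀ hr₀ A hθ0 hθ hT₀ hKT₀ (hamTuningMap ρ h₀))
    (Ssys : (fun k => HamSpace ℂ d (fieldWt h (L : ℝ) d k) ((L : ℝ) ^ k) (L ^ (d * k))) 0 → (k : ℕ) → (fun k => HamSpace ℂ d (fieldWt h (L : ℝ) d k) ((L : ℝ) ^ k) (L ^ (d * k))) k → (fun k => activitySpace (abkmNormParams L N Mord R pT r₀ h θbar A (schedDelta δ₀ δ₁ N) fun j => 𝒞 1 j) k) k → (fun k => activitySpace (abkmNormParams L N Mord R pT r₀ h θbar A (schedDelta δ₀ δ₁ N) fun j => 𝒞 1 j) k) (k + 1))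
    (hSsys : Ssys = fun h₀ =>
      rgSQ (L := L) (N := N) (Mord := Mord) (R := R) (p := pT) (r₀ := r₀) (h := h) (θbar := θbar) (A := A)
            (δ₀ := δ₀) (δ₁ := δ₁) (𝒞 := fun j => 𝒞 1 j) (fun j => 𝒞 ((1 : Matrix (Fin d) (Fin d) ℝ) + hamTuningMap ρ h₀) j))
    (Φ : (fun k => HamSpace ℂ d (fieldWt h (L : ℝ) d k) ((L : ℝ) ^ k) (L ^ (d * k))) 0 → (fun k => activitySpace (abkmNormParams L N Mord R pT r₀ h θbar A (schedDelta δ₀ δ₁ N) fun j => 𝒞 1 j) k) N → ℂ)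
    (hΦ : Φ = fun h₀ yN =>
      (∫ φ, ((yN : activitySpace (abkmNormParams L N Mord R pT r₀ h θbar A (schedDelta δ₀ δ₁ N) fun j => 𝒞 1 j) N) : Finset (Fin d → ZMod M) → ((Fin d → ZMod M) → ℝ) → ℂ) Finset.univ φ
            ∂(stepMeasure (𝒞 ((1 : Matrix (Fin d) (Fin d) ℝ) + hamTuningMap ρ h₀) (N + 1)))))
    -- the `q`-regularity of the steps and of the last-scale functional (census F4/F5), `N`-uniform constants
    {a₀ b₀ l₀ a₀₀ b₀₀ l₀₀ l₀' σ₂ lI lI' lII : ℝ} (ha0 : 0 ≤ a₀) (hb0 : 0 ≤ b₀) (hl0 : 0 ≤ l₀) (ha00 : 0 ≤ a₀₀)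
    (hb00 : 0 ≤ b₀₀) (hl00 : 0 ≤ l₀₀) (hl0' : 0 ≤ l₀') (hσ₂0 : 0 ≤ σ₂) (hlI : 0 ≤ lI) (hlI' : 0 ≤ lI') (hlII : 0 ≤ lII)
    (ha : ∀ h₀ h₀' : HamSpace ℂ d (fieldWt h (L : ℝ) d 0) ((L : ℝ) ^ 0) (L ^ (d * 0)), ‖h₀‖ ≤ ρ → ‖h₀'‖ ≤ ρ → ∀ k, k < N →
      ∀ w : HamSpace ℂ d (fieldWt h (L : ℝ) d (k + 1)) ((L : ℝ) ^ (k + 1)) (L ^ (d * (k + 1))),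
        ‖(Asys h₀ k).symm w - (Asys h₀' k).symm w‖ ≤ a₀ * ‖h₀ - h₀'‖ * ‖w‖)
    (hb : ∀ h₀ h₀' : HamSpace ℂ d (fieldWt h (L : ℝ) d 0) ((L : ℝ) ^ 0) (L ^ (d * 0)), ‖h₀‖ ≤ ρ → ‖h₀'‖ ≤ ρ → ∀ k, k < N →
      ∀ (v : activitySpace (abkmNormParams L N Mord R pT r₀ h θbar A (schedDelta δ₀ δ₁ N) fun j => 𝒞 1 j) k) (cv : ℝ), activityNormLE (abkmNormParams L N Mord R pT r₀ h θbar A (schedDelta δ₀ δ₁ N) fun j => 𝒞 1 j) k v cv →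
        ‖Bsys h₀ k v - Bsys h₀' k v‖ ≤ b₀ * ‖h₀ - h₀'‖ * cv)
    (hl : ∀ h₀ h₀' : HamSpace ℂ d (fieldWt h (L : ℝ) d 0) ((L : ℝ) ^ 0) (L ^ (d * 0)), ‖h₀‖ ≤ ρ → ‖h₀'‖ ≤ ρ → ∀ k, k < N →
      ∀ (u : HamSpace ℂ d (fieldWt h (L : ℝ) d k) ((L : ℝ) ^ k) (L ^ (d * k))) (v : activitySpace (abkmNormParams L N Mord R pT r₀ h θbar A (schedDelta δ₀ δ₁ N) fun j => 𝒞 1 j) k) (cv : ℝ), ‖u‖ ≤ r → activityNormLE (abkmNormParams L N Mord R pT r₀ h θbar A (schedDelta δ₀ δ₁ N) fun j => 𝒞 1 j) k v cv → cv ≤ r →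
        activityNormLE (abkmNormParams L N Mord R pT r₀ h θbar A (schedDelta δ₀ δ₁ N) fun j => 𝒞 1 j) (k + 1) (Ssys h₀ k u v - Ssys h₀' k u v) (l₀ * ‖h₀ - h₀'‖ * max ‖u‖ cv))
    (hA2 : ∀ h₀ y z : HamSpace ℂ d (fieldWt h (L : ℝ) d 0) ((L : ℝ) ^ 0) (L ^ (d * 0)), ‖h₀‖ ≤ ρ → ‖h₀ + y‖ ≤ ρ → ‖h₀ + z‖ ≤ ρ → ‖h₀ + y + z‖ ≤ ρ →
      ∀ k, k < N → ∀ w : HamSpace ℂ d (fieldWt h (L : ℝ) d (k + 1)) ((L : ℝ) ^ (k + 1)) (L ^ (d * (k + 1))),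
        ‖(Asys (h₀ + y + z) k).symm w - (Asys (h₀ + y) k).symm w
          - (Asys (h₀ + z) k).symm w + (Asys h₀ k).symm w‖ ≤ a₀₀ * ‖y‖ * ‖z‖ * ‖w‖)
    (hB2 : ∀ h₀ y z : HamSpace ℂ d (fieldWt h (L : ℝ) d 0) ((L : ℝ) ^ 0) (L ^ (d * 0)), ‖h₀‖ ≤ ρ → ‖h₀ + y‖ ≤ ρ → ‖h₀ + z‖ ≤ ρ → ‖h₀ + y + z‖ ≤ ρ →
      ∀ k, k < N → ∀ (v : activitySpace (abkmNormParams L N Mord R pT r₀ h θbar A (schedDelta δ₀ δ₁ N) fun j => 𝒞 1 j) k) (cv : ℝ), activityNormLE (abkmNormParams L N Mord R pT r₀ h θbar A (schedDelta δ₀ δ₁ N) fun j => 𝒞 1 j) k v cv →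
        ‖Bsys (h₀ + y + z) k v - Bsys (h₀ + y) k v - Bsys (h₀ + z) k v + Bsys h₀ k v‖
          ≤ b₀₀ * ‖y‖ * ‖z‖ * cv)
    (hS2 : ∀ h₀ y z : HamSpace ℂ d (fieldWt h (L : ℝ) d 0) ((L : ℝ) ^ 0) (L ^ (d * 0)), ‖h₀‖ ≤ ρ → ‖h₀ + y‖ ≤ ρ → ‖h₀ + z‖ ≤ ρ → ‖h₀ + y + z‖ ≤ ρ →
      ∀ k, k < N → ∀ (u : HamSpace ℂ d (fieldWt h (L : ℝ) d k) ((L : ℝ) ^ k) (L ^ (d * k))) (v : activitySpace (abkmNormParams L N Mord R pT r₀ h θbar A (schedDelta δ₀ δ₁ N) fun j => 𝒞 1 j) k) (cv : ℝ), ‖u‖ ≤ r → activityNormLE (abkmNormParams L N Mord R pT r₀ h θbar A (schedDelta δ₀ δ₁ N) fun j => 𝒞 1 j) k v cv → cv ≤ r →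
        activityNormLE (abkmNormParams L N Mord R pT r₀ h θbar A (schedDelta δ₀ δ₁ N) fun j => 𝒞 1 j) (k + 1) (Ssys (h₀ + y + z) k u v - Ssys (h₀ + y) k u v - Ssys (h₀ + z) k u v + Ssys h₀ k u v) (l₀₀ * ‖y‖ * ‖z‖ * max ‖u‖ cv))
    (hl' : ∀ h₀ h₀' : HamSpace ℂ d (fieldWt h (L : ℝ) d 0) ((L : ℝ) ^ 0) (L ^ (d * 0)), ‖h₀‖ ≤ ρ → ‖h₀'‖ ≤ ρ → ∀ k, k < N →
      ∀ (u u' : HamSpace ℂ d (fieldWt h (L : ℝ) d k) ((L : ℝ) ^ k) (L ^ (d * k))) (v v' : activitySpace (abkmNormParams L N Mord R pT r₀ h θbar A (schedDelta δ₀ δ₁ N) fun j => 𝒞 1 j) k) (cv cv' cd : ℝ), ‖u‖ ≤ r → ‖u'‖ ≤ r →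
        activityNormLE (abkmNormParams L N Mord R pT r₀ h θbar A (schedDelta δ₀ δ₁ N) fun j => 𝒞 1 j) k v cv → cv ≤ r → activityNormLE (abkmNormParams L N Mord R pT r₀ h θbar A (schedDelta δ₀ δ₁ N) fun j => 𝒞 1 j) k v' cv' → cv' ≤ r → activityNormLE (abkmNormParams L N Mord R pT r₀ h θbar A (schedDelta δ₀ δ₁ N) fun j => 𝒞 1 j) k (v - v') cd →
        activityNormLE (abkmNormParams L N Mord R pT r₀ h θbar A (schedDelta δ₀ δ₁ N) fun j => 𝒞 1 j) (k + 1) ((Ssys h₀' k u v - Ssys h₀ k u v) - (Ssys h₀' k u' v' - Ssys h₀ k u' v')) (l₀' * ‖h₀' - h₀‖ * max ‖u - u'‖ cd))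
    (hσ2 : ∀ h₀ : HamSpace ℂ d (fieldWt h (L : ℝ) d 0) ((L : ℝ) ^ 0) (L ^ (d * 0)), ‖h₀‖ ≤ ρ → ∀ k, k < N →
      ∀ (u y z : HamSpace ℂ d (fieldWt h (L : ℝ) d k) ((L : ℝ) ^ k) (L ^ (d * k))) (v y' z' : activitySpace (abkmNormParams L N Mord R pT r₀ h θbar A (schedDelta δ₀ δ₁ N) fun j => 𝒞 1 j) k) (cv cvy cvz cvyz cy cz : ℝ),
        ‖u‖ ≤ r → ‖u + y‖ ≤ r → ‖u + z‖ ≤ r → ‖u + y + z‖ ≤ r →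
        activityNormLE (abkmNormParams L N Mord R pT r₀ h θbar A (schedDelta δ₀ δ₁ N) fun j => 𝒞 1 j) k v cv → cv ≤ r → activityNormLE (abkmNormParams L N Mord R pT r₀ h θbar A (schedDelta δ₀ δ₁ N) fun j => 𝒞 1 j) k (v + y') cvy → cvy ≤ r → activityNormLE (abkmNormParams L N Mord R pT r₀ h θbar A (schedDelta δ₀ δ₁ N) fun j => 𝒞 1 j) k (v + z') cvz → cvz ≤ r →
        activityNormLE (abkmNormParams L N Mord R pT r₀ h θbar A (schedDelta δ₀ δ₁ N) fun j => 𝒞 1 j) k (v + y' + z') cvyz → cvyz ≤ r → activityNormLE (abkmNormParams L N Mord R pT r₀ h θbar A (schedDelta δ₀ δ₁ N) fun j => 𝒞 1 j) k y' cy → activityNormLE (abkmNormParams L N Mord R pT r₀ h θbar A (schedDelta δ₀ δ₁ N) fun j => 𝒞 1 j) k z' cz →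
        activityNormLE (abkmNormParams L N Mord R pT r₀ h θbar A (schedDelta δ₀ δ₁ N) fun j => 𝒞 1 j) (k + 1) (Ssys h₀ k (u + y + z) (v + y' + z') - Ssys h₀ k (u + y) (v + y') - Ssys h₀ k (u + z) (v + z') + Ssys h₀ k u v) (σ₂ * max ‖y‖ cy * max ‖z‖ cz))
    (hΦ2 : ∀ h₀ h₀' : HamSpace ℂ d (fieldWt h (L : ℝ) d 0) ((L : ℝ) ^ 0) (L ^ (d * 0)), ‖h₀‖ ≤ ρ → ‖h₀'‖ ≤ ρ → ∀ (yN : activitySpace (abkmNormParams L N Mord R pT r₀ h θbar A (schedDelta δ₀ δ₁ N) fun j => 𝒞 1 j) N) (cv : ℝ), activityNormLE (abkmNormParams L N Mord R pT r₀ h θbar A (schedDelta δ₀ δ₁ N) fun j => 𝒞 1 j) N yN cv → cv ≤ r →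
      ‖Φ h₀ yN - Φ h₀' yN‖ ≤ lI * ‖h₀ - h₀'‖ * cv)
    (hΦ12 : ∀ h₀ h₀' : HamSpace ℂ d (fieldWt h (L : ℝ) d 0) ((L : ℝ) ^ 0) (L ^ (d * 0)), ‖h₀‖ ≤ ρ → ‖h₀'‖ ≤ ρ → ∀ (yN yN' : activitySpace (abkmNormParams L N Mord R pT r₀ h θbar A (schedDelta δ₀ δ₁ N) fun j => 𝒞 1 j) N) (cy cy' cd : ℝ),
      activityNormLE (abkmNormParams L N Mord R pT r₀ h θbar A (schedDelta δ₀ δ₁ N) fun j => 𝒞 1 j) N yN cy → cy ≤ r → activityNormLE (abkmNormParams L N Mord R pT r₀ h θbar A (schedDelta δ₀ δ₁ N) fun j => 𝒞 1 j) N yN' cy' → cy' ≤ r → activityNormLE (abkmNormParams L N Mord R pT r₀ h θbar A (schedDelta δ₀ δ₁ N) fun j => 𝒞 1 j) N (yN - yN') cd →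
      ‖(Φ h₀ yN - Φ h₀' yN) - (Φ h₀ yN' - Φ h₀' yN')‖ ≤ lI' * ‖h₀ - h₀'‖ * cd)
    (hΦ22 : ∀ h₀ y z : HamSpace ℂ d (fieldWt h (L : ℝ) d 0) ((L : ℝ) ^ 0) (L ^ (d * 0)), ‖h₀‖ ≤ ρ → ‖h₀ + y‖ ≤ ρ → ‖h₀ + z‖ ≤ ρ → ‖h₀ + y + z‖ ≤ ρ →
      ∀ (yN : activitySpace (abkmNormParams L N Mord R pT r₀ h θbar A (schedDelta δ₀ δ₁ N) fun j => 𝒞 1 j) N) (cv : ℝ), activityNormLE (abkmNormParams L N Mord R pT r₀ h θbar A (schedDelta δ₀ δ₁ N) fun j => 𝒞 1 j) N yN cv → cv ≤ r →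
      ‖Φ (h₀ + y + z) yN - Φ (h₀ + y) yN - Φ (h₀ + z) yN + Φ h₀ yN‖ ≤ lII * ‖y‖ * ‖z‖ * cv)
    (hsmallF : max (16 * Real.exp (3 / 8) * (ρ𝒦 * Real.exp (fieldWt h (L : ℝ) d 0 / (L : ℝ) ^ 0)) * A) (max (l₀ * ε / η) ((3 / 4 * b₀ + a₀ * (η + ((L : ℝ) ^ d * (pi2BoundConst d (((2 * R + 2 : ℕ) : ℝ) + ((d / 2 + 1 : ℕ) : ℝ)) * (A𝒫' * A⁻¹))) + 2 * ρ * b₀)) * ε)) ≤ (1 - κ) / 2)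
    :
    ∃ fE : ((Fin d → ℝ) → ℂ) → ℂ,
      (∀ K : (Fin d → ℝ) → ℂ, ContDiff ℝ r₀ K →
        (∀ s, s ≤ r₀ → ∀ z : Fin d → ℝ, ‖iteratedFDeriv ℝ s K z‖ ≤ ρ𝒦 * Real.exp ((∑ i, z i ^ 2) / 4)) →
        (∀ z, K (-z) = (starRingEnd ℂ) (K z)) →
        ∃ x₀ : HamSpace ℂ d (fieldWt h (L : ℝ) d 0) ((L : ℝ) ^ 0) (L ^ (d * 0)), IsIotaHam (HamSpace.toHam x₀) ∧ ‖x₀‖ ≤ ρ ∧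
          ‖(∫ φ, pcirc 1 (fun Y => expNegH (HamSpace.toHam x₀) Y φ)
            (fun X => initKH K (HamSpace.toHam x₀) X φ) Finset.univ
          ∂(tailMeasure (fun jj => 𝒞 ((1 : Matrix (Fin d) (Fin d) ℝ) + hamQuadForm (HamSpace.toHam x₀)) jj) N N)) - 1‖ ≤ ε * η ^ N * A⁻¹ * A𝒫' ∧
          fE K = ((((Real.log (formChangeConst (M := M) (1 : Matrix (Fin d) (Fin d) ℝ)
              (1 + hamQuadForm (HamSpace.toHam x₀)))) : ℝ) : ℂ)
          + (Fintype.card (Fin d → ZMod M) : ℂ) * (HamSpace.toHam x₀) (Sum.inl ())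
          + Complex.log (∫ φ, pcirc 1 (fun Y => expNegH (HamSpace.toHam x₀) Y φ)
            (fun X => initKH K (HamSpace.toHam x₀) X φ) Finset.univ
          ∂(tailMeasure (fun jj => 𝒞 ((1 : Matrix (Fin d) (Fin d) ℝ) + hamQuadForm (HamSpace.toHam x₀)) jj) N N)))) ∧
      (∀ (K U : (Fin d → ℝ) → ℂ) (u₁ : ℝ),
        ContDiff ℝ r₀ K →
        (∀ s, s ≤ r₀ → ∀ z : Fin d → ℝ, ‖iteratedFDeriv ℝ s K z‖ ≤ ρ𝒦 * Real.exp ((∑ i, z i ^ 2) / 4)) →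
        (∀ z, K (-z) = (starRingEnd ℂ) (K z)) →
        ContDiff ℝ r₀ U →
        (∀ s, s ≤ r₀ → ∀ z : Fin d → ℝ,
          ‖iteratedFDeriv ℝ s (fun z => K z + U z) z‖ ≤ ρ𝒦 * Real.exp ((∑ i, z i ^ 2) / 4)) →
        (∀ z, (fun z => K z + U z) (-z) = (starRingEnd ℂ) ((fun z => K z + U z) z)) →
        (∀ s, s ≤ r₀ → ∀ z : Fin d → ℝ, ‖iteratedFDeriv ℝ s U z‖ ≤ u₁ * Real.exp ((∑ i, z i ^ 2) / 4)) →
        0 ≤ u₁ → Real.exp (1 / 4) * ((ρ𝒦 + u₁) * Real.exp (fieldWt h (L : ℝ) d 0 / (L : ℝ) ^ 0)) * A ≤ 1 / 2 →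
        ‖fE (fun z => K z + U z) - fE K‖ ≤ ((2 * (d : ℝ) ^ 2 / (((L ^ (d * 0) : ℕ) : ℝ) * (fieldWt h (L : ℝ) d 0 / (L : ℝ) ^ 0) ^ 2)) * (2 * (Real.exp (1 / 4) * Real.exp (fieldWt h (L : ℝ) d 0 / (L : ℝ) ^ 0) * A) / (1 - κ)) + (2 * (Real.exp (1 / 4) * Real.exp (fieldWt h (L : ℝ) d 0 / (L : ℝ) ^ 0) * A) / (1 - κ)) + ((A⁻¹ * A𝒫') + lI * ε) * (2 * (Real.exp (1 / 4) * Real.exp (fieldWt h (L : ℝ) d 0 / (L : ℝ) ^ 0) * A) / (1 - κ)) / (1 - ε)) * (Fintype.card (Fin d → ZMod M) : ℝ) * u₁) ∧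
      (∀ (K U V : (Fin d → ℝ) → ℂ) (u₁ u₂ : ℝ),
        ContDiff ℝ r₀ K → ContDiff ℝ r₀ U → ContDiff ℝ r₀ V →
        (∀ s, s ≤ r₀ → ∀ z : Fin d → ℝ, ‖iteratedFDeriv ℝ s K z‖ ≤ ρ𝒦 * Real.exp ((∑ i, z i ^ 2) / 4)) →
        (∀ s, s ≤ r₀ → ∀ z : Fin d → ℝ,
          ‖iteratedFDeriv ℝ s (fun z => K z + U z) z‖ ≤ ρ𝒦 * Real.exp ((∑ i, z i ^ 2) / 4)) →
        (∀ s, s ≤ r₀ → ∀ z : Fin d → ℝ,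
          ‖iteratedFDeriv ℝ s (fun z => K z + V z) z‖ ≤ ρ𝒦 * Real.exp ((∑ i, z i ^ 2) / 4)) →
        (∀ s, s ≤ r₀ → ∀ z : Fin d → ℝ,
          ‖iteratedFDeriv ℝ s (fun z => K z + U z + V z) z‖ ≤ ρ𝒦 * Real.exp ((∑ i, z i ^ 2) / 4)) →
        (∀ z, K (-z) = (starRingEnd ℂ) (K z)) →
        (∀ z, (fun z => K z + U z) (-z) = (starRingEnd ℂ) ((fun z => K z + U z) z)) →
        (∀ z, (fun z => K z + V z) (-z) = (starRingEnd ℂ) ((fun z => K z + V z) z)) →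
        (∀ z, (fun z => K z + U z + V z) (-z) = (starRingEnd ℂ) ((fun z => K z + U z + V z) z)) →
        (∀ s, s ≤ r₀ → ∀ z : Fin d → ℝ, ‖iteratedFDeriv ℝ s U z‖ ≤ u₁ * Real.exp ((∑ i, z i ^ 2) / 4)) →
        (∀ s, s ≤ r₀ → ∀ z : Fin d → ℝ, ‖iteratedFDeriv ℝ s V z‖ ≤ u₂ * Real.exp ((∑ i, z i ^ 2) / 4)) →
        0 ≤ u₁ → 0 ≤ u₂ →
        (Real.exp (1 / 4) + 16 * Real.exp (3 / 8) * (2 * ρ) + 16 * Real.exp (3 / 8) * (2 * ρ)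
        + 256 * Real.exp (1 / 4) * (2 * ρ) * (2 * ρ)) * ((ρ𝒦 + u₁ + u₂) * Real.exp (fieldWt h (L : ℝ) d 0 / (L : ℝ) ^ 0)) * A ≤ 1 / 2 →
        ‖fE (fun z => K z + U z + V z) - fE (fun z => K z + U z) - fE (fun z => K z + V z) + fE K‖
          ≤ ((2 * (d : ℝ) ^ 2 / (((L ^ (d * 0) : ℕ) : ℝ) * (fieldWt h (L : ℝ) d 0 / (L : ℝ) ^ 0) ^ 2)) * (2 * (max (((3 / 2 : ℝ) * (16 * Real.exp (3 / 8)) ^ 2 + 128 * Real.exp (1 / 4)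
          + 192 * Real.exp (3 / 8) * (Real.exp (fieldWt h (L : ℝ) d 0 / (L : ℝ) ^ 0) * A)
          + 6 * (Real.exp (fieldWt h (L : ℝ) d 0 / (L : ℝ) ^ 0) * Real.exp (1 / 4) * A) ^ 2) * (1 + 2 * (Real.exp (1 / 4) * Real.exp (fieldWt h (L : ℝ) d 0 / (L : ℝ) ^ 0) * A) / (1 - κ)) ^ 2)
          (max ((σ₂ * (2 * (Real.exp (1 / 4) * Real.exp (fieldWt h (L : ℝ) d 0 / (L : ℝ) ^ 0) * A) / (1 - κ)) * (2 * (Real.exp (1 / 4) * Real.exp (fieldWt h (L : ℝ) d 0 / (L : ℝ) ^ 0) * A) / (1 - κ))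
              + l₀' * (2 * (Real.exp (1 / 4) * Real.exp (fieldWt h (L : ℝ) d 0 / (L : ℝ) ^ 0) * A) / (1 - κ)) * ((2 * (Real.exp (1 / 4) * Real.exp (fieldWt h (L : ℝ) d 0 / (L : ℝ) ^ 0) * A) / (1 - κ)) + (2 * (Real.exp (1 / 4) * Real.exp (fieldWt h (L : ℝ) d 0 / (L : ℝ) ^ 0) * A) / (1 - κ)))
              + l₀₀ * (2 * (Real.exp (1 / 4) * Real.exp (fieldWt h (L : ℝ) d 0 / (L : ℝ) ^ 0) * A) / (1 - κ)) * (2 * (Real.exp (1 / 4) * Real.exp (fieldWt h (L : ℝ) d 0 / (L : ℝ) ^ 0) * A) / (1 - κ)) * ε) / η)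
            (3 / 4 * (b₀ * (2 * (Real.exp (1 / 4) * Real.exp (fieldWt h (L : ℝ) d 0 / (L : ℝ) ^ 0) * A) / (1 - κ)) * ((2 * (Real.exp (1 / 4) * Real.exp (fieldWt h (L : ℝ) d 0 / (L : ℝ) ^ 0) * A) / (1 - κ)) + (2 * (Real.exp (1 / 4) * Real.exp (fieldWt h (L : ℝ) d 0 / (L : ℝ) ^ 0) * A) / (1 - κ)))
                + b₀₀ * (2 * (Real.exp (1 / 4) * Real.exp (fieldWt h (L : ℝ) d 0 / (L : ℝ) ^ 0) * A) / (1 - κ)) * (2 * (Real.exp (1 / 4) * Real.exp (fieldWt h (L : ℝ) d 0 / (L : ℝ) ^ 0) * A) / (1 - κ)) * ε)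
              + (η + ((L : ℝ) ^ d * (pi2BoundConst d (((2 * R + 2 : ℕ) : ℝ) + ((d / 2 + 1 : ℕ) : ℝ)) * (A𝒫' * A⁻¹)))) * (a₀ * (2 * (Real.exp (1 / 4) * Real.exp (fieldWt h (L : ℝ) d 0 / (L : ℝ) ^ 0) * A) / (1 - κ)) * ((2 * (Real.exp (1 / 4) * Real.exp (fieldWt h (L : ℝ) d 0 / (L : ℝ) ^ 0) * A) / (1 - κ)) + (2 * (Real.exp (1 / 4) * Real.exp (fieldWt h (L : ℝ) d 0 / (L : ℝ) ^ 0) * A) / (1 - κ)))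
                + a₀₀ * (2 * (Real.exp (1 / 4) * Real.exp (fieldWt h (L : ℝ) d 0 / (L : ℝ) ^ 0) * A) / (1 - κ)) * (2 * (Real.exp (1 / 4) * Real.exp (fieldWt h (L : ℝ) d 0 / (L : ℝ) ^ 0) * A) / (1 - κ)) * ε)
              + 2 * (a₀ * (2 * (Real.exp (1 / 4) * Real.exp (fieldWt h (L : ℝ) d 0 / (L : ℝ) ^ 0) * A) / (1 - κ))) * (b₀ * (2 * (Real.exp (1 / 4) * Real.exp (fieldWt h (L : ℝ) d 0 / (L : ℝ) ^ 0) * A) / (1 - κ))) * ε))) / (1 - κ)) + 2 * (2 * (d : ℝ) ^ 2 / (((L ^ (d * 0) : ℕ) : ℝ) * (fieldWt h (L : ℝ) d 0 / (L : ℝ) ^ 0) ^ 2)) ^ 2 * (2 * (Real.exp (1 / 4) * Real.exp (fieldWt h (L : ℝ) d 0 / (L : ℝ) ^ 0) * A) / (1 - κ)) ^ 2 + (2 * (max (((3 / 2 : ℝ) * (16 * Real.exp (3 / 8)) ^ 2 + 128 * Real.exp (1 / 4)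
          + 192 * Real.exp (3 / 8) * (Real.exp (fieldWt h (L : ℝ) d 0 / (L : ℝ) ^ 0) * A)
          + 6 * (Real.exp (fieldWt h (L : ℝ) d 0 / (L : ℝ) ^ 0) * Real.exp (1 / 4) * A) ^ 2) * (1 + 2 * (Real.exp (1 / 4) * Real.exp (fieldWt h (L : ℝ) d 0 / (L : ℝ) ^ 0) * A) / (1 - κ)) ^ 2)
          (max ((σ₂ * (2 * (Real.exp (1 / 4) * Real.exp (fieldWt h (L : ℝ) d 0 / (L : ℝ) ^ 0) * A) / (1 - κ)) * (2 * (Real.exp (1 / 4) * Real.exp (fieldWt h (L : ℝ) d 0 / (L : ℝ) ^ 0) * A) / (1 - κ))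
              + l₀' * (2 * (Real.exp (1 / 4) * Real.exp (fieldWt h (L : ℝ) d 0 / (L : ℝ) ^ 0) * A) / (1 - κ)) * ((2 * (Real.exp (1 / 4) * Real.exp (fieldWt h (L : ℝ) d 0 / (L : ℝ) ^ 0) * A) / (1 - κ)) + (2 * (Real.exp (1 / 4) * Real.exp (fieldWt h (L : ℝ) d 0 / (L : ℝ) ^ 0) * A) / (1 - κ)))
              + l₀₀ * (2 * (Real.exp (1 / 4) * Real.exp (fieldWt h (L : ℝ) d 0 / (L : ℝ) ^ 0) * A) / (1 - κ)) * (2 * (Real.exp (1 / 4) * Real.exp (fieldWt h (L : ℝ) d 0 / (L : ℝ) ^ 0) * A) / (1 - κ)) * ε) / η)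
            (3 / 4 * (b₀ * (2 * (Real.exp (1 / 4) * Real.exp (fieldWt h (L : ℝ) d 0 / (L : ℝ) ^ 0) * A) / (1 - κ)) * ((2 * (Real.exp (1 / 4) * Real.exp (fieldWt h (L : ℝ) d 0 / (L : ℝ) ^ 0) * A) / (1 - κ)) + (2 * (Real.exp (1 / 4) * Real.exp (fieldWt h (L : ℝ) d 0 / (L : ℝ) ^ 0) * A) / (1 - κ)))
                + b₀₀ * (2 * (Real.exp (1 / 4) * Real.exp (fieldWt h (L : ℝ) d 0 / (L : ℝ) ^ 0) * A) / (1 - κ)) * (2 * (Real.exp (1 / 4) * Real.exp (fieldWt h (L : ℝ) d 0 / (L : ℝ) ^ 0) * A) / (1 - κ)) * ε)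
              + (η + ((L : ℝ) ^ d * (pi2BoundConst d (((2 * R + 2 : ℕ) : ℝ) + ((d / 2 + 1 : ℕ) : ℝ)) * (A𝒫' * A⁻¹)))) * (a₀ * (2 * (Real.exp (1 / 4) * Real.exp (fieldWt h (L : ℝ) d 0 / (L : ℝ) ^ 0) * A) / (1 - κ)) * ((2 * (Real.exp (1 / 4) * Real.exp (fieldWt h (L : ℝ) d 0 / (L : ℝ) ^ 0) * A) / (1 - κ)) + (2 * (Real.exp (1 / 4) * Real.exp (fieldWt h (L : ℝ) d 0 / (L : ℝ) ^ 0) * A) / (1 - κ)))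
                + a₀₀ * (2 * (Real.exp (1 / 4) * Real.exp (fieldWt h (L : ℝ) d 0 / (L : ℝ) ^ 0) * A) / (1 - κ)) * (2 * (Real.exp (1 / 4) * Real.exp (fieldWt h (L : ℝ) d 0 / (L : ℝ) ^ 0) * A) / (1 - κ)) * ε)
              + 2 * (a₀ * (2 * (Real.exp (1 / 4) * Real.exp (fieldWt h (L : ℝ) d 0 / (L : ℝ) ^ 0) * A) / (1 - κ))) * (b₀ * (2 * (Real.exp (1 / 4) * Real.exp (fieldWt h (L : ℝ) d 0 / (L : ℝ) ^ 0) * A) / (1 - κ))) * ε))) / (1 - κ))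
      + ((A⁻¹ * A𝒫') * (2 * (max (((3 / 2 : ℝ) * (16 * Real.exp (3 / 8)) ^ 2 + 128 * Real.exp (1 / 4)
          + 192 * Real.exp (3 / 8) * (Real.exp (fieldWt h (L : ℝ) d 0 / (L : ℝ) ^ 0) * A)
          + 6 * (Real.exp (fieldWt h (L : ℝ) d 0 / (L : ℝ) ^ 0) * Real.exp (1 / 4) * A) ^ 2) * (1 + 2 * (Real.exp (1 / 4) * Real.exp (fieldWt h (L : ℝ) d 0 / (L : ℝ) ^ 0) * A) / (1 - κ)) ^ 2)
          (max ((σ₂ * (2 * (Real.exp (1 / 4) * Real.exp (fieldWt h (L : ℝ) d 0 / (L : ℝ) ^ 0) * A) / (1 - κ)) * (2 * (Real.exp (1 / 4) * Real.exp (fieldWt h (L : ℝ) d 0 / (L : ℝ) ^ 0) * A) / (1 - κ))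
              + l₀' * (2 * (Real.exp (1 / 4) * Real.exp (fieldWt h (L : ℝ) d 0 / (L : ℝ) ^ 0) * A) / (1 - κ)) * ((2 * (Real.exp (1 / 4) * Real.exp (fieldWt h (L : ℝ) d 0 / (L : ℝ) ^ 0) * A) / (1 - κ)) + (2 * (Real.exp (1 / 4) * Real.exp (fieldWt h (L : ℝ) d 0 / (L : ℝ) ^ 0) * A) / (1 - κ)))
              + l₀₀ * (2 * (Real.exp (1 / 4) * Real.exp (fieldWt h (L : ℝ) d 0 / (L : ℝ) ^ 0) * A) / (1 - κ)) * (2 * (Real.exp (1 / 4) * Real.exp (fieldWt h (L : ℝ) d 0 / (L : ℝ) ^ 0) * A) / (1 - κ)) * ε) / η)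
            (3 / 4 * (b₀ * (2 * (Real.exp (1 / 4) * Real.exp (fieldWt h (L : ℝ) d 0 / (L : ℝ) ^ 0) * A) / (1 - κ)) * ((2 * (Real.exp (1 / 4) * Real.exp (fieldWt h (L : ℝ) d 0 / (L : ℝ) ^ 0) * A) / (1 - κ)) + (2 * (Real.exp (1 / 4) * Real.exp (fieldWt h (L : ℝ) d 0 / (L : ℝ) ^ 0) * A) / (1 - κ)))
                + b₀₀ * (2 * (Real.exp (1 / 4) * Real.exp (fieldWt h (L : ℝ) d 0 / (L : ℝ) ^ 0) * A) / (1 - κ)) * (2 * (Real.exp (1 / 4) * Real.exp (fieldWt h (L : ℝ) d 0 / (L : ℝ) ^ 0) * A) / (1 - κ)) * ε)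
              + (η + ((L : ℝ) ^ d * (pi2BoundConst d (((2 * R + 2 : ℕ) : ℝ) + ((d / 2 + 1 : ℕ) : ℝ)) * (A𝒫' * A⁻¹)))) * (a₀ * (2 * (Real.exp (1 / 4) * Real.exp (fieldWt h (L : ℝ) d 0 / (L : ℝ) ^ 0) * A) / (1 - κ)) * ((2 * (Real.exp (1 / 4) * Real.exp (fieldWt h (L : ℝ) d 0 / (L : ℝ) ^ 0) * A) / (1 - κ)) + (2 * (Real.exp (1 / 4) * Real.exp (fieldWt h (L : ℝ) d 0 / (L : ℝ) ^ 0) * A) / (1 - κ)))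
                + a₀₀ * (2 * (Real.exp (1 / 4) * Real.exp (fieldWt h (L : ℝ) d 0 / (L : ℝ) ^ 0) * A) / (1 - κ)) * (2 * (Real.exp (1 / 4) * Real.exp (fieldWt h (L : ℝ) d 0 / (L : ℝ) ^ 0) * A) / (1 - κ)) * ε)
              + 2 * (a₀ * (2 * (Real.exp (1 / 4) * Real.exp (fieldWt h (L : ℝ) d 0 / (L : ℝ) ^ 0) * A) / (1 - κ))) * (b₀ * (2 * (Real.exp (1 / 4) * Real.exp (fieldWt h (L : ℝ) d 0 / (L : ℝ) ^ 0) * A) / (1 - κ))) * ε))) / (1 - κ)) + 2 * lI' * (2 * (Real.exp (1 / 4) * Real.exp (fieldWt h (L : ℝ) d 0 / (L : ℝ) ^ 0) * A) / (1 - κ)) ^ 2 + (lI * (2 * (max (((3 / 2 : ℝ) * (16 * Real.exp (3 / 8)) ^ 2 + 128 * Real.exp (1 / 4)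
          + 192 * Real.exp (3 / 8) * (Real.exp (fieldWt h (L : ℝ) d 0 / (L : ℝ) ^ 0) * A)
          + 6 * (Real.exp (fieldWt h (L : ℝ) d 0 / (L : ℝ) ^ 0) * Real.exp (1 / 4) * A) ^ 2) * (1 + 2 * (Real.exp (1 / 4) * Real.exp (fieldWt h (L : ℝ) d 0 / (L : ℝ) ^ 0) * A) / (1 - κ)) ^ 2)
          (max ((σ₂ * (2 * (Real.exp (1 / 4) * Real.exp (fieldWt h (L : ℝ) d 0 / (L : ℝ) ^ 0) * A) / (1 - κ)) * (2 * (Real.exp (1 / 4) * Real.exp (fieldWt h (L : ℝ) d 0 / (L : ℝ) ^ 0) * A) / (1 - κ))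
              + l₀' * (2 * (Real.exp (1 / 4) * Real.exp (fieldWt h (L : ℝ) d 0 / (L : ℝ) ^ 0) * A) / (1 - κ)) * ((2 * (Real.exp (1 / 4) * Real.exp (fieldWt h (L : ℝ) d 0 / (L : ℝ) ^ 0) * A) / (1 - κ)) + (2 * (Real.exp (1 / 4) * Real.exp (fieldWt h (L : ℝ) d 0 / (L : ℝ) ^ 0) * A) / (1 - κ)))
              + l₀₀ * (2 * (Real.exp (1 / 4) * Real.exp (fieldWt h (L : ℝ) d 0 / (L : ℝ) ^ 0) * A) / (1 - κ)) * (2 * (Real.exp (1 / 4) * Real.exp (fieldWt h (L : ℝ) d 0 / (L : ℝ) ^ 0) * A) / (1 - κ)) * ε) / η)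
            (3 / 4 * (b₀ * (2 * (Real.exp (1 / 4) * Real.exp (fieldWt h (L : ℝ) d 0 / (L : ℝ) ^ 0) * A) / (1 - κ)) * ((2 * (Real.exp (1 / 4) * Real.exp (fieldWt h (L : ℝ) d 0 / (L : ℝ) ^ 0) * A) / (1 - κ)) + (2 * (Real.exp (1 / 4) * Real.exp (fieldWt h (L : ℝ) d 0 / (L : ℝ) ^ 0) * A) / (1 - κ)))
                + b₀₀ * (2 * (Real.exp (1 / 4) * Real.exp (fieldWt h (L : ℝ) d 0 / (L : ℝ) ^ 0) * A) / (1 - κ)) * (2 * (Real.exp (1 / 4) * Real.exp (fieldWt h (L : ℝ) d 0 / (L : ℝ) ^ 0) * A) / (1 - κ)) * ε)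
              + (η + ((L : ℝ) ^ d * (pi2BoundConst d (((2 * R + 2 : ℕ) : ℝ) + ((d / 2 + 1 : ℕ) : ℝ)) * (A𝒫' * A⁻¹)))) * (a₀ * (2 * (Real.exp (1 / 4) * Real.exp (fieldWt h (L : ℝ) d 0 / (L : ℝ) ^ 0) * A) / (1 - κ)) * ((2 * (Real.exp (1 / 4) * Real.exp (fieldWt h (L : ℝ) d 0 / (L : ℝ) ^ 0) * A) / (1 - κ)) + (2 * (Real.exp (1 / 4) * Real.exp (fieldWt h (L : ℝ) d 0 / (L : ℝ) ^ 0) * A) / (1 - κ)))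
                + a₀₀ * (2 * (Real.exp (1 / 4) * Real.exp (fieldWt h (L : ℝ) d 0 / (L : ℝ) ^ 0) * A) / (1 - κ)) * (2 * (Real.exp (1 / 4) * Real.exp (fieldWt h (L : ℝ) d 0 / (L : ℝ) ^ 0) * A) / (1 - κ)) * ε)
              + 2 * (a₀ * (2 * (Real.exp (1 / 4) * Real.exp (fieldWt h (L : ℝ) d 0 / (L : ℝ) ^ 0) * A) / (1 - κ))) * (b₀ * (2 * (Real.exp (1 / 4) * Real.exp (fieldWt h (L : ℝ) d 0 / (L : ℝ) ^ 0) * A) / (1 - κ))) * ε))) / (1 - κ)) + lII * (2 * (Real.exp (1 / 4) * Real.exp (fieldWt h (L : ℝ) d 0 / (L : ℝ) ^ 0) * A) / (1 - κ)) ^ 2) * ε) / (1 - 3 * ε)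
      + ((A⁻¹ * A𝒫') + lI * ε) ^ 2 * (2 * (Real.exp (1 / 4) * Real.exp (fieldWt h (L : ℝ) d 0 / (L : ℝ) ^ 0) * A) / (1 - κ)) ^ 2 / (1 - 3 * ε) ^ 2)
            * (Fintype.card (Fin d → ZMod M) : ℝ) * u₁ * u₂) := by
  have hh : 0 < h := Fact.out
  have hA : 0 < A := by linarith
  have hρ0 : 0 ≤ ρ := by linarith
  have hεr' : ε ≤ r := by linarith
  have hερ' : ε ≤ ρ := by linarith
  have hρ16 : ρ ≤ 1 / 16 := hρ64.trans (by norm_num)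
  have hqε2 : 2 * (d : ℝ) ^ 2 / (((L ^ (d * 0) : ℕ) : ℝ) * (fieldWt h (L : ℝ) d 0 / (L : ℝ) ^ 0) ^ 2) * ε ≤ 1 / 2 :=
    hqε.trans (by norm_num)
  have hLq : (0 : ℝ) ≤ 2 * (d : ℝ) ^ 2 / (((L ^ (d * 0) : ℕ) : ℝ) * (fieldWt h (L : ℝ) d 0 / (L : ℝ) ^ 0) ^ 2) := by
    positivity
  classical
  subst hAsys hBsys hSsys hΦ
  have hex : ∀ K : (Fin d → ℝ) → ℂ, ContDiff ℝ r₀ K →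
      (∀ s, s ≤ r₀ → ∀ z : Fin d → ℝ, ‖iteratedFDeriv ℝ s K z‖ ≤ ρ𝒦 * Real.exp ((∑ i, z i ^ 2) / 4)) →
      (∀ z, K (-z) = (starRingEnd ℂ) (K z)) →
      ∃ x₀ : HamSpace ℂ d (fieldWt h (L : ℝ) d 0) ((L : ℝ) ^ 0) (L ^ (d * 0)), IsIotaHam (HamSpace.toHam x₀) ∧ ‖x₀‖ ≤ ρ ∧
        ∃ x : ∀ k, HamSpace ℂ d (fieldWt h (L : ℝ) d k) ((L : ℝ) ^ k) (L ^ (d * k)),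
          RGFlow.IsTunedQ (E := (fun k => HamSpace ℂ d (fieldWt h (L : ℝ) d k) ((L : ℝ) ^ k) (L ^ (d * k)))) (F := (fun k => activitySpace (abkmNormParams L N Mord R pT r₀ h θbar A (schedDelta δ₀ δ₁ N) fun j => 𝒞 1 j) k)) N
            (rgA L h (fun jj => 𝒞 ((1 : Matrix (Fin d) (Fin d) ℝ) + hamTuningMap ρ x₀) jj))
            (rgBT hd hMord hMR hLodd hL hM hθbar hlam hn hn2 hnñ hc hC1 hallA hB pT r₀ hr₀ A hθ0 hθ hT₀ hKT₀ (hamTuningMap ρ x₀))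
            (rgSQ (L := L) (N := N) (Mord := Mord) (R := R) (p := pT) (r₀ := r₀) (h := h) (θbar := θbar) (A := A)
            (δ₀ := δ₀) (δ₁ := δ₁) (𝒞 := fun j => 𝒞 1 j) (fun jj => 𝒞 ((1 : Matrix (Fin d) (Fin d) ℝ) + hamTuningMap ρ x₀) jj))
            (initAct (N := N) (Mord := Mord) (R := R) (p := pT) (r₀ := r₀) (θbar := θbar) (A := A) (δ₀ := δ₀)
            (δ₁ := δ₁) (𝒞 := fun j => 𝒞 1 j) K x₀) x ∧
          RGFlow.InTubeQ (E := (fun k => HamSpace ℂ d (fieldWt h (L : ℝ) d k) ((L : ℝ) ^ k) (L ^ (d * k)))) (F := (fun k => activitySpace (abkmNormParams L N Mord R pT r₀ h θbar A (schedDelta δ₀ δ₁ N) fun j => 𝒞 1 j) k)) N η ε (activityNormLE (abkmNormParams L N Mord R pT r₀ h θbar A (schedDelta δ₀ δ₁ N) fun j => 𝒞 1 j))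
            (rgSQ (L := L) (N := N) (Mord := Mord) (R := R) (p := pT) (r₀ := r₀) (h := h) (θbar := θbar) (A := A)
            (δ₀ := δ₀) (δ₁ := δ₁) (𝒞 := fun j => 𝒞 1 j) (fun jj => 𝒞 ((1 : Matrix (Fin d) (Fin d) ℝ) + hamTuningMap ρ x₀) jj))
            (initAct (N := N) (Mord := Mord) (R := R) (p := pT) (r₀ := r₀) (θbar := θbar) (A := A) (δ₀ := δ₀)
            (δ₁ := δ₁) (𝒞 := fun j => 𝒞 1 j) K x₀) x ∧
          x 0 = x₀ :=
    fun K hK hKb hKι => exists_tuned_initial_iota_of_torusFRD (h := h) hd hMord hMR hLodd hL hR2 hM hθbar hlam hn hn2 hnñ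
      hc hC1 hallA hB hp hpM hr₀ hδ₀ hδ₁ hh0 hh2 hθ0 hθ hT₀ hKT₀ hA𝒫' hA1 hA𝒫A hsmall hr0 hr hv hωA hc3A hc2A hη hη1 hκ₁
      hκ₂ hκ hε hεr' hερ' hρ16 hK hKb h𝒦small h𝒦ε hKι (hamTuningMap ρ) (fun x => hamTuningMap_isSymm ρ x)
      (fun x => (entrySum_hamTuningMap_le hρ0 x).trans hqT₀) hLq
      (fun x x' hx hx' => entrySum_hamTuningMap_sub_le x x' hx hx')
  choose x₀f hιf hρf xf htrf htuf hxf using hex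
  refine ⟨fun K => if hK : ContDiff ℝ r₀ K ∧
      (∀ s, s ≤ r₀ → ∀ z : Fin d → ℝ, ‖iteratedFDeriv ℝ s K z‖ ≤ ρ𝒦 * Real.exp ((∑ i, z i ^ 2) / 4)) ∧
      (∀ z, K (-z) = (starRingEnd ℂ) (K z)) then
      ((((Real.log (formChangeConst (M := M) (1 : Matrix (Fin d) (Fin d) ℝ)
              (1 + hamQuadForm (HamSpace.toHam (x₀f K hK.1 hK.2.1 hK.2.2))))) : ℝ) : ℂ)
          + (Fintype.card (Fin d → ZMod M) : ℂ) * (HamSpace.toHam (x₀f K hK.1 hK.2.1 hK.2.2)) (Sum.inl ())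
          + Complex.log (∫ φ, pcirc 1 (fun Y => expNegH (HamSpace.toHam (x₀f K hK.1 hK.2.1 hK.2.2)) Y φ)
            (fun X => initKH K (HamSpace.toHam (x₀f K hK.1 hK.2.1 hK.2.2)) X φ) Finset.univ
          ∂(tailMeasure (fun jj => 𝒞 ((1 : Matrix (Fin d) (Fin d) ℝ) + hamQuadForm (HamSpace.toHam (x₀f K hK.1 hK.2.1 hK.2.2))) jj) N N))) else 0, ?_, ?_, ?_⟩
  · intro K hK hKb hKι
    have hcK : (ContDiff ℝ r₀ K ∧
      (∀ s, s ≤ r₀ → ∀ z : Fin d → ℝ, ‖iteratedFDeriv ℝ s K z‖ ≤ ρ𝒦 * Real.exp ((∑ i, z i ^ 2) / 4)) ∧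
      (∀ z, K (-z) = (starRingEnd ℂ) (K z))) := ⟨hK, hKb, hKι⟩
    refine ⟨x₀f K hK hKb hKι, hιf K hK hKb hKι, hρf K hK hKb hKι, ?_, by beta_reduce; rw [dif_pos hcK]⟩
    exact (integral_flowStart_eq_one_add_lastScaleInt hd hMord hMR hLodd hL hR2 hM hθbar hlam hn hn2 hnñ hc hC1 hallA hB
      hp hpM hr₀ hδ₀ hδ₁ hh0 hh2 hθ0 hθ hT₀ hKT₀ hA𝒫' hA1 hA𝒫A hsmall hr hv hωA hc3A hc2A hη hη1 hε hεr' hερ' hρ16 hK hKb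
      h𝒦small hp4 hqT₀ (hρf K hK hKb hKι) (htrf K hK hKb hKι) (htuf K hK hKb hKι) (hxf K hK hKb hKι)).2
  · intro K U u₁ hK hKb hKι hU hKUb hKUι hUb hu₁ hpert1
    have hcK : (ContDiff ℝ r₀ K ∧
      (∀ s, s ≤ r₀ → ∀ z : Fin d → ℝ, ‖iteratedFDeriv ℝ s K z‖ ≤ ρ𝒦 * Real.exp ((∑ i, z i ^ 2) / 4)) ∧
      (∀ z, K (-z) = (starRingEnd ℂ) (K z))) := ⟨hK, hKb, hKι⟩
    have hcKU : (ContDiff ℝ r₀ (fun z => K z + U z) ∧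
      (∀ s, s ≤ r₀ → ∀ z : Fin d → ℝ, ‖iteratedFDeriv ℝ s (fun z => K z + U z) z‖ ≤ ρ𝒦 * Real.exp ((∑ i, z i ^ 2) / 4)) ∧
      (∀ z, (fun z => K z + U z) (-z) = (starRingEnd ℂ) ((fun z => K z + U z) z))) := ⟨hK.add hU, hKUb, hKUι⟩
    beta_reduce
    rw [dif_pos hcKU, dif_pos hcK]
    exact norm_freeEnergy_sub_le_of_package hd hMord hMR hLodd hL hR2 hM hθbar hlam hn hn2 hnñ hc hC1 hallA hB hp hpM hr₀
      hδ₀ hδ₁ hh0 hh2 hθ0 hθ hT₀ hKT₀ hA𝒫' hA1 hA𝒫A hsmall hr0 hr hv hωA hc3A hc2A hη hη1 hκ₁ hκ₂ hκ hε hεr' hερ' hρ16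
      hqT₀ hK hU hKb hKUb hUb hu₁ h𝒦small hpert1 _ rfl _ rfl _ rfl _ rfl ha0 hb0 hl0 hlI ha hb hl hΦ2 hsmallF
      (x₀f _ (hK.add hU) hKUb hKUι) (x₀f K hK hKb hKι) (xf _ (hK.add hU) hKUb hKUι) (xf K hK hKb hKι)
      (htrf _ (hK.add hU) hKUb hKUι) (htuf _ (hK.add hU) hKUb hKUι) (hxf _ (hK.add hU) hKUb hKUι)
      (htrf K hK hKb hKι) (htuf K hK hKb hKι) (hxf K hK hKb hKι) hp4 hqε2
  · intro K U V u₁ u₂ hK hU hV hKb hKUb hKVb hKUVb hKι hKUι hKVι hKUVι hUb hVb hu₁ hu₂ hpert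
    set Kf : Bool → Bool → (Fin d → ℝ) → ℂ := fun i j =>
      bif i then (bif j then (fun z => K z + U z + V z) else (fun z => K z + U z))
      else (bif j then (fun z => K z + V z) else K) with hKf
    have hKfd : ∀ i j, ContDiff ℝ r₀ (Kf i j) := by
      intro i j; cases i <;> cases j
      · exact hK
      · exact hK.add hV
      · exact hK.add hU
      · exact (hK.add hU).add hV
    have hKfb : ∀ i j, ∀ s, s ≤ r₀ → ∀ z : Fin d → ℝ,
        ‖iteratedFDeriv ℝ s (Kf i j) z‖ ≤ ρ𝒦 * Real.exp ((∑ i, z i ^ 2) / 4) := by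
      intro i j; cases i <;> cases j
      · exact hKb
      · exact hKVb
      · exact hKUb
      · exact hKUVb
    have hKfι : ∀ i j, ∀ z, Kf i j (-z) = (starRingEnd ℂ) (Kf i j z) := by
      intro i j; cases i <;> cases j
      · exact hKι
      · exact hKVι
      · exact hKUι
      · exact hKUVι
    have h3 := norm_secondDiff_freeEnergy_le_of_package hd hMord hMR hLodd hL hR2 hM hθbar hlam hn hn2 hnñ hc hC1 hallA hB
      hp hpM hr₀ hδ₀ hδ₁ hh0 hh2 hθ0 hθ hT₀ hKT₀ hA𝒫' hA1 hA𝒫A hsmall hr0 hr hv hωA hc3A hc2A hη hη1 hκ₁ hκ₂ hκ hε hεr hερ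
      hρ64 hqT₀ hK hU hV hKb hKUb hKVb hKUVb hUb hVb hu₁ hu₂ h𝒦small hpert Kf rfl rfl rfl rfl _ rfl _ rfl _ rfl _ rfl ha0
      hb0 hl0 ha00 hb00 hl00 hl0' hσ₂0 hlI hlI' hlII ha hb hl hA2 hB2 hS2 hl' hσ2 hΦ2 hΦ12 hΦ22 hsmallF
      (fun i j => x₀f (Kf i j) (hKfd i j) (hKfb i j) (hKfι i j)) (fun i j => xf (Kf i j) (hKfd i j) (hKfb i j) (hKfι i j))
      (fun i j => htrf (Kf i j) (hKfd i j) (hKfb i j) (hKfι i j))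
      (fun i j => htuf (Kf i j) (hKfd i j) (hKfb i j) (hKfι i j))
      (fun i j => hxf (Kf i j) (hKfd i j) (hKfb i j) (hKfι i j)) hp4 hqε
    have hcK : (ContDiff ℝ r₀ K ∧
      (∀ s, s ≤ r₀ → ∀ z : Fin d → ℝ, ‖iteratedFDeriv ℝ s K z‖ ≤ ρ𝒦 * Real.exp ((∑ i, z i ^ 2) / 4)) ∧
      (∀ z, K (-z) = (starRingEnd ℂ) (K z))) := ⟨hK, hKb, hKι⟩
    have hcKU : (ContDiff ℝ r₀ (fun z => K z + U z) ∧
      (∀ s, s ≤ r₀ → ∀ z : Fin d → ℝ, ‖iteratedFDeriv ℝ s (fun z => K z + U z) z‖ ≤ ρ𝒦 * Real.exp ((∑ i, z i ^ 2) / 4)) ∧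
      (∀ z, (fun z => K z + U z) (-z) = (starRingEnd ℂ) ((fun z => K z + U z) z))) := ⟨hK.add hU, hKUb, hKUι⟩
    have hcKV : (ContDiff ℝ r₀ (fun z => K z + V z) ∧
      (∀ s, s ≤ r₀ → ∀ z : Fin d → ℝ, ‖iteratedFDeriv ℝ s (fun z => K z + V z) z‖ ≤ ρ𝒦 * Real.exp ((∑ i, z i ^ 2) / 4)) ∧
      (∀ z, (fun z => K z + V z) (-z) = (starRingEnd ℂ) ((fun z => K z + V z) z))) := ⟨hK.add hV, hKVb, hKVι⟩
    have hcKUV : (ContDiff ℝ r₀ (fun z => K z + U z + V z) ∧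
      (∀ s, s ≤ r₀ → ∀ z : Fin d → ℝ, ‖iteratedFDeriv ℝ s (fun z => K z + U z + V z) z‖ ≤ ρ𝒦 * Real.exp ((∑ i, z i ^ 2) / 4)) ∧
      (∀ z, (fun z => K z + U z + V z) (-z) = (starRingEnd ℂ) ((fun z => K z + U z + V z) z))) := ⟨(hK.add hU).add hV, hKUVb, hKUVι⟩
    beta_reduce
    rw [dif_pos hcKUV, dif_pos hcKU, dif_pos hcKV, dif_pos hcK]
    exact h3

end Package

end Summit.HubbardSuperconductivity.HubbardSuperconductivity.Theorems.ComplexGFF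

end
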